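import Summits.HubbardSuperconductivity.HubbardSuperconductivity.Theses.YangSpectral
import Summits.HubbardSuperconductivity.HubbardSuperconductivity.Theorems.TwTipContinuation.Negative.TipNormalForm
import Literature.MathematicalPhysics.QuantumLattice.PairCorrelationsProofs
import Literature.MathematicalPhysics.QuantumLattice.PairCorrelationsDWaveSymmetryProofs
import Literature.MathematicalPhysics.QuantumLattice.HubbardWave0PosSemidefProofs

/-!
# Route `YangSpectral` — glue support `YangSpectralBridge` (stmt-HubbardSuperconductivity-8624)

`YangSpectralBridge : YangSpectralThesis → HubbardSuperconductivity` (repaired thesis ⇒ summit):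
an even-side rerun of the Q-D5 bridge. At the thesis' `(U, δ)` and for a summit-hypothesis sequence
`(N, ψ)` (literally the thesis' `Hyp`), eventually in even `L` there is a unit `B₁g` pair
wavefunction `v` MAXIMISING the Rayleigh quotient `q(w) = re ⟨w, ρ₂(ψ_L) w⟩` on the `B₁g` unit
sphere, with `q(v) ≥ c N_L` and `|⟨v, φ_d⟩|² ≥ c L²`. The linear-algebra core, proved here for any
Hermitian matrix `A`, any predicate `p` closed under `+` and `•` (here `IsDWaveSymmetric`) and any
`p`-unit maximiser `v`:

* FIRST-ORDER CONDITION (`rayleigh_max_first_order`): `⟨v, A u⟩ = q(v) ⟨v, u⟩` for every `u`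
  with `p u` — from the maximality at the `p`-vectors `v + t z̄ • u` after rescaling to the sphere
  (`z = ⟨v, A u⟩ - q(v)⟨v, u⟩`, `t = 1/(C+1)`), which forces `|z|² (C + 2) ≤ 0`;
* FLOOR (`rayleigh_max_floor`): if moreover `re ⟨x, A x⟩ ≥ 0` for all `x`, then
  `q(v) · |⟨v, φ⟩|² ≤ re ⟨φ, A φ⟩` for every `φ` with `p φ` — write `φ = w + α v`,
  `α = ⟨v, φ⟩`, `w ⊥ v`; the cross terms vanish by the first-order condition and `⟨w, A w⟩ ≥ 0`.

With `A = ρ₂(ψ_L) ⪰ 0` (`twoParticleRDM_posSemidef`), `φ = φ_d` (`B₁g`,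
`isDWaveSymmetric_pairFieldWavefunction_dWave_holds`) and Yang's identity
`re ⟨ψ, Δ_dᴴ Δ_d ψ⟩ = re φ_dᴴ ρ₂ φ_d` (`expect_pairField_eq_dotProduct_twoParticleRDM`):
`re ⟨ψ_L, Δ_dᴴ Δ_d ψ_L⟩ ≥ c N_L · c L² ≥ c² (1-δ)/2 · L⁴` once `(1-δ) L² ≥ 4`
(`N_L = 2⌊(1-δ)L²/2⌋ ≥ (1-δ)L² - 2`). The even-side `liminf` bookkeeping is the one of
`summitMatrix_of_everyGSOrder` run per sequence (`lroTerm_eq`, `expect_pairIntensity_le`,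
`le_liminf_of_le`). Sources: C. N. Yang, Rev. Mod. Phys. 34 (1962) 694, §4 (eq. (22));
D. J. Scalapino, Phys. Rep. 250 (1995) 329, §2. No new definitions.
-/

-- the mandated namespace `Summit.<Summit>.<Problem>.Theorems` repeats `HubbardSuperconductivity`
-- (single-problem summit, D-0017), which the `dupNamespace` linter flags on every declaration
set_option linter.dupNamespace false

namespace Summit.HubbardSuperconductivity.HubbardSuperconductivity.Theorems

open Matrix Filter
open Literature.MathematicalPhysics.QuantumLattice Literature.Probability.LatticeModels
open Summit.HubbardSuperconductivity.TwTipContinuation.Negative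
  (lroTerm_eq side_pow_pos expect_pairIntensity_le)
open scoped ComplexOrder

section LinearAlgebra

variable {n : Type*} [Fintype n]

/-- Hermitian symmetry of the sesquilinear form: `⟨x, A y⟩ = conj ⟨y, A x⟩` for `Aᴴ = A`.
[folklore] -/
theorem star_dotProduct_mulVec_comm {A : Matrix n n ℂ} (hA : A.IsHermitian) (x y : n → ℂ) :
    star x ⬝ᵥ (A *ᵥ y) = star (star y ⬝ᵥ (A *ᵥ x)) := by
  have h : star (A *ᵥ x) ⬝ᵥ y = star x ⬝ᵥ (A *ᵥ y) := by
    rw [star_mulVec, ← dotProduct_mulVec, hA.eq]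
  rw [← h, ← star_dotProduct_star, star_star]

/-- Expansion of the Hermitian quadratic form at `v + c • u`:
`re ⟨v + c u, A (v + c u)⟩ = re ⟨v, A v⟩ + 2 re (c ⟨v, A u⟩) + |c|² re ⟨u, A u⟩`. [folklore] -/
theorem re_quadratic_add_smul {A : Matrix n n ℂ} (hA : A.IsHermitian) (v u : n → ℂ) (c : ℂ) :
    (star (v + c • u) ⬝ᵥ (A *ᵥ (v + c • u))).re =
      (star v ⬝ᵥ (A *ᵥ v)).re + 2 * (c * (star v ⬝ᵥ (A *ᵥ u))).re +
        Complex.normSq c * (star u ⬝ᵥ (A *ᵥ u)).re := by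
  have hcross : (star c * (star u ⬝ᵥ (A *ᵥ v))).re = (c * (star v ⬝ᵥ (A *ᵥ u))).re := by
    rw [star_dotProduct_mulVec_comm hA u v, ← star_mul', Complex.star_def, Complex.conj_re]
  rw [mulVec_add, mulVec_smul, star_add, star_smul, add_dotProduct, dotProduct_add, dotProduct_add,
    smul_dotProduct, smul_dotProduct, dotProduct_smul, dotProduct_smul, smul_eq_mul, smul_eq_mul,
    smul_eq_mul, smul_eq_mul]
  simp only [Complex.add_re]
  rw [hcross]
  have hsq : (star c * (c * (star u ⬝ᵥ A *ᵥ u))).re = Complex.normSq c * (star u ⬝ᵥ A *ᵥ u).re := by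
    rw [← mul_assoc, Complex.star_def, ← Complex.normSq_eq_conj_mul_self, Complex.re_ofReal_mul]
  rw [hsq]
  ring

/-- The same expansion for the norm square (`A = 1`). [folklore] -/
theorem re_normSq_add_smul (v u : n → ℂ) (c : ℂ) [DecidableEq n] :
    (star (v + c • u) ⬝ᵥ (v + c • u)).re =
      (star v ⬝ᵥ v).re + 2 * (c * (star v ⬝ᵥ u)).re + Complex.normSq c * (star u ⬝ᵥ u).re := by
  have h := re_quadratic_add_smul (isHermitian_one (n := n) (α := ℂ)) v u c
  simpa only [one_mulVec] using h

/-- `⟨x, x⟩` is the real number `re ⟨x, x⟩`. [folklore] -/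
theorem star_dotProduct_self_eq_re (x : n → ℂ) :
    star x ⬝ᵥ x = ((star x ⬝ᵥ x).re : ℂ) := by
  obtain ⟨_, him⟩ := Complex.nonneg_iff.1 (dotProduct_star_self_nonneg x)
  exact Complex.ext (by simp) (by simp [← him])

/-- Scaling form of maximality: if the unit `p`-vector `v` maximises `re ⟨w, A w⟩` among unit
`p`-vectors (`p` closed under scalars), then `re ⟨x, A x⟩ ≤ q(v) · re ⟨x, x⟩` for every `p`-vector
`x`. [folklore] -/
theorem rayleigh_max_scaled {A : Matrix n n ℂ} (p : (n → ℂ) → Prop)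
    (hsmul : ∀ (c : ℂ) (a : n → ℂ), p a → p (c • a)) {v : n → ℂ}
    (hmax : ∀ w, star w ⬝ᵥ w = 1 → p w → (star w ⬝ᵥ (A *ᵥ w)).re ≤ (star v ⬝ᵥ (A *ᵥ v)).re)
    {x : n → ℂ} (hpx : p x) :
    (star x ⬝ᵥ (A *ᵥ x)).re ≤ (star v ⬝ᵥ (A *ᵥ v)).re * (star x ⬝ᵥ x).re := by
  by_cases hx : x = 0
  · subst hx
    simp
  set r : ℝ := (star x ⬝ᵥ x).re with hr
  have hrpos : 0 < r := by
    have h := Matrix.dotProduct_star_self_pos_iff.2 hx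
    rw [star_dotProduct_self_eq_re x] at h
    exact_mod_cast h
  set s : ℝ := (Real.sqrt r)⁻¹ with hs
  have hs2 : s ^ 2 * r = 1 := by
    rw [hs, inv_pow, Real.sq_sqrt hrpos.le, inv_mul_cancel₀ hrpos.ne']
  set x' : n → ℂ := (s : ℂ) • x with hx'
  have hpx' : p x' := hsmul _ _ hpx
  have hunit : star x' ⬝ᵥ x' = 1 := by
    rw [hx', star_smul, smul_dotProduct, dotProduct_smul, smul_smul, Complex.star_def,
      Complex.conj_ofReal, star_dotProduct_self_eq_re x, smul_eq_mul]
    rw [← hr]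
    have : (s : ℂ) * (s : ℂ) * (r : ℂ) = ((s ^ 2 * r : ℝ) : ℂ) := by push_cast; ring
    rw [this, hs2]
    simp
  have hq : (star x' ⬝ᵥ (A *ᵥ x')).re = s ^ 2 * (star x ⬝ᵥ (A *ᵥ x)).re := by
    rw [hx', mulVec_smul, star_smul, smul_dotProduct, dotProduct_smul, smul_smul, Complex.star_def,
      Complex.conj_ofReal, smul_eq_mul]
    have : (s : ℂ) * (s : ℂ) = ((s ^ 2 : ℝ) : ℂ) := by push_cast; ring
    rw [this, Complex.re_ofReal_mul]
  have key := hmax x' hunit hpx'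
  rw [hq] at key
  -- s² q(x) ≤ q(v)  ⇒  q(x) ≤ q(v) r   (multiply by r > 0 and use s² r = 1)
  have h1 : s ^ 2 * (star x ⬝ᵥ (A *ᵥ x)).re * r ≤ (star v ⬝ᵥ (A *ᵥ v)).re * r :=
    mul_le_mul_of_nonneg_right key hrpos.le
  calc (star x ⬝ᵥ (A *ᵥ x)).re = s ^ 2 * (star x ⬝ᵥ (A *ᵥ x)).re * r := by
        rw [mul_comm (s ^ 2), mul_assoc, hs2, mul_one]
    _ ≤ (star v ⬝ᵥ (A *ᵥ v)).re * r := h1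

/-- **First-order condition of a constrained Rayleigh maximiser.** Let `A` be Hermitian, `p` a
predicate on vectors closed under addition and scalar multiplication, and `v` a unit `p`-vector
maximising `re ⟨w, A w⟩` among unit `p`-vectors. Then `⟨v, A u⟩ = q(v) ⟨v, u⟩` for every
`p`-vector `u` (`q(v) = re ⟨v, A v⟩`), i.e. `v` is an eigenvector of the compression of `A` to
the `p`-subspace. [folklore] -/
theorem rayleigh_max_first_order [DecidableEq n] {A : Matrix n n ℂ} (hA : A.IsHermitian)
    (p : (n → ℂ) → Prop) (hadd : ∀ a b : n → ℂ, p a → p b → p (a + b))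
    (hsmul : ∀ (c : ℂ) (a : n → ℂ), p a → p (c • a)) {v : n → ℂ} (hv1 : star v ⬝ᵥ v = 1)
    (hpv : p v)
    (hmax : ∀ w, star w ⬝ᵥ w = 1 → p w → (star w ⬝ᵥ (A *ᵥ w)).re ≤ (star v ⬝ᵥ (A *ᵥ v)).re)
    {u : n → ℂ} (hpu : p u) :
    star v ⬝ᵥ (A *ᵥ u) = ((star v ⬝ᵥ (A *ᵥ v)).re : ℂ) * (star v ⬝ᵥ u) := by
  set lam : ℝ := (star v ⬝ᵥ (A *ᵥ v)).re with hlam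
  set a : ℂ := star v ⬝ᵥ u with ha
  set b : ℂ := star v ⬝ᵥ (A *ᵥ u) with hb
  set z : ℂ := b - (lam : ℂ) * a with hz
  -- the defect C ≥ 0 at u
  set C : ℝ := lam * (star u ⬝ᵥ u).re - (star u ⬝ᵥ (A *ᵥ u)).re with hC
  have hC0 : 0 ≤ C := by
    have h := rayleigh_max_scaled p hsmul hmax hpu
    rw [hC]; linarith
  -- maximality at v + c • u with c = t * conj z, t = 1/(C+1)
  set t : ℝ := 1 / (C + 1) with ht
  have htpos : 0 < t := by rw [ht]; positivity
  set c : ℂ := (t : ℂ) * star z with hc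
  have hpx : p (v + c • u) := hadd _ _ hpv (hsmul _ _ hpu)
  have hineq := rayleigh_max_scaled p hsmul hmax hpx
  rw [re_quadratic_add_smul hA v u c, re_normSq_add_smul v u c, hv1, Complex.one_re] at hineq
  -- hineq : lam + 2 re(c b) + |c|² q_u ≤ lam * (1 + 2 re(c a) + |c|² r_u)
  have hcz : c * z = ((t * Complex.normSq z : ℝ) : ℂ) := by
    rw [hc, mul_assoc, Complex.star_def, ← Complex.normSq_eq_conj_mul_self]
    push_cast
    ring
  have hnc : Complex.normSq c = t ^ 2 * Complex.normSq z := by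
    rw [hc, Complex.normSq_mul, Complex.normSq_ofReal, Complex.star_def, Complex.normSq_conj]
    ring
  have hre : (c * b).re - lam * (c * a).re = t * Complex.normSq z := by
    have : c * b - (lam : ℂ) * (c * a) = c * z := by rw [hz]; ring
    have h2 := congrArg Complex.re this
    rw [hcz, Complex.ofReal_re, Complex.sub_re, Complex.re_ofReal_mul] at h2
    exact h2
  have key : 2 * (t * Complex.normSq z) ≤ t ^ 2 * Complex.normSq z * C := by
    rw [hnc] at hineq
    rw [hC]
    nlinarith [hineq, hre]
  -- with t = 1/(C+1): |z|² (C + 2) ≤ 0, hence z = 0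
  have hz0 : Complex.normSq z = 0 := by
    have hnn := Complex.normSq_nonneg z
    have h1 : t * C ≤ 1 := by
      rw [ht, div_mul_eq_mul_div, one_mul, div_le_one (by positivity)]
      linarith
    -- 2 t |z|² ≤ t² |z|² C = t |z|² (t C) ≤ t |z|²  ⇒ t |z|² ≤ 0
    have h2 : t ^ 2 * Complex.normSq z * C ≤ t * Complex.normSq z := by
      have : t ^ 2 * Complex.normSq z * C = t * Complex.normSq z * (t * C) := by ring
      rw [this]
      exact mul_le_of_le_one_right (by positivity) h1
    have h3 : t * Complex.normSq z ≤ 0 := by linarith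
    have h4 : 0 ≤ t * Complex.normSq z := by positivity
    have h5 : t * Complex.normSq z = 0 := le_antisymm h3 h4
    rcases mul_eq_zero.1 h5 with h | h
    · exact absurd h htpos.ne'
    · exact h
  have hzero : z = 0 := Complex.normSq_eq_zero.1 hz0
  have : b = (lam : ℂ) * a := by
    have h := hzero
    rw [hz, sub_eq_zero] at h
    exact h
  exact this

/-- **Floor from the first-order condition.** If moreover `re ⟨x, A x⟩ ≥ 0` for all `x`, then
`q(v) · |⟨v, φ⟩|² ≤ re ⟨φ, A φ⟩` for every `p`-vector `φ`: write `φ = w + α v` with `α = ⟨v, φ⟩`,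
`⟨v, w⟩ = 0`; the cross terms vanish (`⟨v, A w⟩ = q(v)⟨v, w⟩ = 0`) and `⟨w, A w⟩ ≥ 0`. [folklore] -/
theorem rayleigh_max_floor [DecidableEq n] {A : Matrix n n ℂ} (hA : A.IsHermitian)
    (hpsd : ∀ x : n → ℂ, 0 ≤ (star x ⬝ᵥ (A *ᵥ x)).re)
    (p : (n → ℂ) → Prop) (hadd : ∀ a b : n → ℂ, p a → p b → p (a + b))
    (hsmul : ∀ (c : ℂ) (a : n → ℂ), p a → p (c • a)) {v : n → ℂ} (hv1 : star v ⬝ᵥ v = 1)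
    (hpv : p v)
    (hmax : ∀ w, star w ⬝ᵥ w = 1 → p w → (star w ⬝ᵥ (A *ᵥ w)).re ≤ (star v ⬝ᵥ (A *ᵥ v)).re)
    {φ : n → ℂ} (hpφ : p φ) :
    (star v ⬝ᵥ (A *ᵥ v)).re * Complex.normSq (star v ⬝ᵥ φ) ≤ (star φ ⬝ᵥ (A *ᵥ φ)).re := by
  set lam : ℝ := (star v ⬝ᵥ (A *ᵥ v)).re with hlam
  set α : ℂ := star v ⬝ᵥ φ with hα
  set w : n → ℂ := φ + (-α) • v with hw
  have hpw : p w := hadd _ _ hpφ (hsmul _ _ hpv)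
  have hvw : star v ⬝ᵥ w = 0 := by
    rw [hw, dotProduct_add, dotProduct_smul, hv1, smul_eq_mul, mul_one, ← hα]
    exact add_neg_cancel α
  have hfo := rayleigh_max_first_order hA p hadd hsmul hv1 hpv hmax hpw
  rw [hvw, mul_zero] at hfo
  -- hfo : ⟨v, A w⟩ = 0 ; hence ⟨w, A v⟩ = 0
  have hfo' : star w ⬝ᵥ (A *ᵥ v) = 0 := by
    rw [star_dotProduct_mulVec_comm hA w v, hfo, star_zero]
  have hφ : φ = w + α • v := by rw [hw]; simp
  have hexp := re_quadratic_add_smul hA w v α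
  rw [← hφ, hfo', mul_zero, Complex.zero_re, mul_zero, add_zero] at hexp
  rw [hexp]
  have hww := hpsd w
  nlinarith [Complex.normSq_nonneg α, hww]

end LinearAlgebra

/-! ### The bridge -/

/-- `IsDWaveSymmetric` is closed under addition. [folklore] -/
theorem isDWaveSymmetric_add {L : ℕ} [NeZero L]
    {a b : Orb (FermionTorus 2 L) × Orb (FermionTorus 2 L) → ℂ}
    (ha : IsDWaveSymmetric a) (hb : IsDWaveSymmetric b) : IsDWaveSymmetric (a + b) := by
  intro γ
  have h1 : d4Act γ (a + b) = d4Act γ a + d4Act γ b := by funext p; rfl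
  rw [h1, ha γ, hb γ, smul_add]

/-- `IsDWaveSymmetric` is closed under scalar multiplication. [folklore] -/
theorem isDWaveSymmetric_smul {L : ℕ} [NeZero L] (c : ℂ)
    {a : Orb (FermionTorus 2 L) × Orb (FermionTorus 2 L) → ℂ} (ha : IsDWaveSymmetric a) :
    IsDWaveSymmetric (c • a) := by
  intro γ
  have h1 : d4Act γ (c • a) = c • d4Act γ a := by funext p; rfl
  rw [h1, ha γ, smul_comm]

/-- **The d-wave pair-field floor of a dominant `B₁g` pair mode** (Yang's criterion read through
the nearest-neighbour pair field): if a unit `B₁g` pair wavefunction `v` maximises the `ρ₂(ψ)`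
Rayleigh quotient among unit `B₁g` pair wavefunctions, then
`re ⟨v, ρ₂ v⟩ · |⟨v, φ_d⟩|² ≤ re ⟨ψ, Δ_dᴴ Δ_d ψ⟩`. Yang, Rev. Mod. Phys. 34 (1962) 694, §4.
[folklore] -/
theorem pairIntensity_ge_of_dominant_b1g_mode (L : ℕ) [NeZero L] (ψ : Fock (Orb (FermionTorus 2 L)))
    {v : Orb (FermionTorus 2 L) × Orb (FermionTorus 2 L) → ℂ} (hv1 : star v ⬝ᵥ v = 1)
    (hvd : IsDWaveSymmetric v)
    (hmax : ∀ w : Orb (FermionTorus 2 L) × Orb (FermionTorus 2 L) → ℂ, star w ⬝ᵥ w = 1 →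
      IsDWaveSymmetric w →
        (star w ⬝ᵥ (twoParticleRDM ψ *ᵥ w)).re ≤ (star v ⬝ᵥ (twoParticleRDM ψ *ᵥ v)).re) :
    (star v ⬝ᵥ (twoParticleRDM ψ *ᵥ v)).re *
        ‖star v ⬝ᵥ pairFieldWavefunction dWaveFormFactor L‖ ^ 2 ≤
      (expect ((pairField dWaveFormFactor L)ᴴ * pairField dWaveFormFactor L) ψ).re := by
  classical
  have hpsd : (twoParticleRDM ψ).PosSemidef := PosSemidefTrace.twoParticleRDM_posSemidef ψ
  have hre : ∀ x : Orb (FermionTorus 2 L) × Orb (FermionTorus 2 L) → ℂ,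
      0 ≤ (star x ⬝ᵥ (twoParticleRDM ψ *ᵥ x)).re := fun x =>
    (Complex.nonneg_iff.1 (hpsd.dotProduct_mulVec_nonneg x)).1
  have key := rayleigh_max_floor hpsd.1 hre IsDWaveSymmetric
    (fun a b ha hb => isDWaveSymmetric_add ha hb) (fun c a ha => isDWaveSymmetric_smul c ha)
    hv1 hvd hmax (isDWaveSymmetric_pairFieldWavefunction_dWave_holds L)
  rw [expect_pairField_eq_dotProduct_twoParticleRDM dWaveFormFactor L
    expect_pairAnnihilator_conjTranspose_mul_holds (pairField_eq_pairAnnihilator_dWave L) ψ,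
    Complex.sq_norm]
  exact key

/-- **YangSpectralBridge** (item `stmt-HubbardSuperconductivity-8624`):
`YangSpectralThesis → HubbardSuperconductivity`. Per hypothesis sequence: eventually in even `L`,
`re ⟨ψ_L, Δ_dᴴ Δ_d ψ_L⟩ ≥ c N_L · c L² ≥ (c² (1-δ)/2) L⁴`
(`pairIntensity_ge_of_dominant_b1g_mode`, `N_L = 2⌊(1-δ)L²/2⌋ ≥ (1-δ)L² - 2 ≥ (1-δ)L²/2`
once `(1-δ)L² ≥ 4`), and the even-side `liminf` of the summit's LRO sequence is then
`≥ c²(1-δ)/2 > 0` (terms `re⟨Δ_dᴴΔ_d⟩/(2k)⁴`, bounded above by `C_d²`). Yang (1962) §4;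
Scalapino (1995) §2. [folklore] -/
theorem yangSpectralBridge_proof :
    Summit.HubbardSuperconductivity.HubbardSuperconductivity.Theses.YangSpectral.YangSpectralBridge := by
  unfold Summit.HubbardSuperconductivity.HubbardSuperconductivity.Theses.YangSpectral.YangSpectralBridge
    Summit.HubbardSuperconductivity.HubbardSuperconductivity.Theses.YangSpectral.YangSpectralThesis
  rintro ⟨U, hU, δ, hδ, hThesis⟩
  show Literature.Hubbard.DWaveSuperconductivityHubbard
  refine ⟨U, hU, δ, hδ, fun N ψ hyp => ?_⟩
  obtain ⟨c, hc, hev⟩ := hThesis N ψ hyp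
  have hδ1 : 0 < 1 - δ := by linarith [hδ.2]
  -- the per-sequence floor, eventually in L
  set a : ℝ := c * c * ((1 - δ) / 2) with ha
  have hapos : 0 < a := by positivity
  obtain ⟨L₁, hL₁⟩ := eventually_atTop.1 hev
  -- threshold making (1-δ) L² ≥ 4
  set L₂ : ℕ := ⌈4 / (1 - δ)⌉₊ with hL₂
  change 0 < liminf (fun k : ℕ => (∑ x ∈ halfOpenBox 2 (2 * k), ∑ y ∈ halfOpenBox 2 (2 * k),
          torusPullback (pairFieldCorr dWaveFormFactor ψ) (2 * k) x y) /
        ((halfOpenBox 2 (2 * k)).card : ℝ) ^ 2) atTop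
  have hfloor : ∀ᶠ k in atTop, a ≤ (∑ x ∈ halfOpenBox 2 (2 * k), ∑ y ∈ halfOpenBox 2 (2 * k),
          torusPullback (pairFieldCorr dWaveFormFactor ψ) (2 * k) x y) /
        ((halfOpenBox 2 (2 * k)).card : ℝ) ^ 2 := by
    refine eventually_atTop.2 ⟨L₁ + L₂ + 1, fun k hk => ?_⟩
    haveI : NeZero (2 * k) := ⟨by omega⟩
    have hkL : L₁ ≤ 2 * k := by omega
    obtain ⟨v, hv1, hvd, hvmax, hvq, hvo⟩ := hL₁ (2 * k) hkL (even_two_mul k)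
    obtain ⟨hN, hu, -⟩ := hyp (2 * k) (even_two_mul k)
    rw [lroTerm_eq, le_div_iff₀ (side_pow_pos k)]
    have hmode := pairIntensity_ge_of_dominant_b1g_mode (2 * k) (ψ (2 * k)) hv1 hvd hvmax
    -- N_{2k} ≥ (1-δ)(2k)²/2
    set Lr : ℝ := ((2 * k : ℕ) : ℝ) with hLr
    have hLr2 : 4 / (1 - δ) ≤ Lr := by
      have h1 : (L₂ : ℝ) ≤ Lr := by rw [hLr]; exact_mod_cast (by omega : L₂ ≤ 2 * k)
      exact le_trans (Nat.le_ceil _) h1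
    have hLr1 : 1 ≤ Lr := by rw [hLr]; exact_mod_cast (by omega : 1 ≤ 2 * k)
    have hLsq : 4 ≤ (1 - δ) * Lr ^ 2 := by
      rw [div_le_iff₀ hδ1] at hLr2
      nlinarith
    have hNreal : (1 - δ) * Lr ^ 2 / 2 ≤ (N (2 * k) : ℝ) := by
      rw [hN]
      push_cast
      have hfl := Nat.sub_one_lt_floor ((1 - δ) * Lr ^ 2 / 2)
      rw [hLr] at hfl ⊢
      linarith
    -- chain: a (2k)⁴ ≤ (c N)(c L²) ≤ q(v) |⟨v,φ_d⟩|² ≤ re⟨Δ_dᴴΔ_d⟩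
    have hq0 : 0 ≤ c * (N (2 * k) : ℝ) := by positivity
    have h1 : a * Lr ^ 4 ≤ (c * (N (2 * k) : ℝ)) * (c * Lr ^ 2) := by
      rw [ha]
      have : c * c * ((1 - δ) / 2) * Lr ^ 4 = (c * ((1 - δ) * Lr ^ 2 / 2)) * (c * Lr ^ 2) := by ring
      rw [this]
      exact mul_le_mul_of_nonneg_right (mul_le_mul_of_nonneg_left hNreal hc.le) (by positivity)
    have h2 : (c * (N (2 * k) : ℝ)) * (c * Lr ^ 2) ≤
        (star v ⬝ᵥ (twoParticleRDM (ψ (2 * k)) *ᵥ v)).re *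
          ‖star v ⬝ᵥ pairFieldWavefunction dWaveFormFactor (2 * k)‖ ^ 2 :=
      mul_le_mul hvq hvo (by positivity) (hq0.trans hvq)
    exact h1.trans (h2.trans hmode)
  have hupper : ∀ᶠ k in atTop, (∑ x ∈ halfOpenBox 2 (2 * k), ∑ y ∈ halfOpenBox 2 (2 * k),
          torusPullback (pairFieldCorr dWaveFormFactor ψ) (2 * k) x y) /
        ((halfOpenBox 2 (2 * k)).card : ℝ) ^ 2 ≤
      (∑ e ∈ insert 0 unitSteps, ‖((dWaveFormFactor e / Real.sqrt 2 : ℝ) : ℂ)‖ * 2) ^ 2 := by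
    refine eventually_atTop.2 ⟨1, fun k hk => ?_⟩
    haveI : NeZero (2 * k) := ⟨by omega⟩
    obtain ⟨-, hu, -⟩ := hyp (2 * k) (even_two_mul k)
    rw [lroTerm_eq, div_le_iff₀ (side_pow_pos k)]
    exact expect_pairIntensity_le (2 * k) (ψ (2 * k)) hu
  exact lt_of_lt_of_le hapos (le_liminf_of_le (isCoboundedUnder_ge_of_eventually_le _ hupper) hfloor)

end Summit.HubbardSuperconductivity.HubbardSuperconductivity.Theorems
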